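import Literature.Computability.AlgebraicComplexity.MS21DenseOrbitsHittingSets
import Literature.Computability.AlgebraicComplexity.BrentFormulaDepth
import HarnessLib

/-!
# Medini–Shpilka 2021, toward Thm 32 (closures): every formula is a polynomial-size ANF formula

The step of the printed proof of MS Thm 32 eq. (6) (`cl ANF^{GLaff} = cl ROF^{GL} = cl VP_e`,
arXiv:2102.05632 p0026:L17-L19) that it imports from Gupta–Kayal–Qiao [GKQ14, Prop. 3.2]: "every
size-`s` formula has an ANF formula of size `O(s⁴)`" — an ANF FORMULA being the canonical
read-once alternating normal form `ANF_Δ` (MS Def 8, `MS2021.anf`) applied to AFFINE FORMS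
`ℓ_1, …, ℓ_{4^Δ}` (MS Def 7). PROVED here, with the tree's constants, as

  `MS2021.exists_anf_affine_of_formulaComplexity :
     ∀ g ∈ F[x_1..x_M], ∃ Δ β, 4^Δ ≤ (formulaComplexity g + 1)^16 ∧
       g = ANF_Δ (β₁·x + β₁₀, …)` (affine leaves),

for every commutative semiring `F`, from two ingredients:

* **a depth-`δ` formula is an `ANF_δ`-formula** (`WExpr.exists_anf_leaves`): structural induction on
  the weighted expression (`FormulaUnfolding.lean`), padding with the identities
  `p = ANF_{δ+1}(p-block, 1-block, 0-block, 0-block)`, `c₁ e₁ + c₂ e₂ = e₁ · c₁ + e₂ · c₂`,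
  `e₁ e₂ = e₁ · e₂ + 0 · 0` (`MS2021.anfBlocks`, `MS2021.anfLeafPad`, `aeval_anfBlocks`,
  `aeval_anfLeafPad`); the leaves are variables and constants, i.e. affine forms;
* **Brent's depth reduction** `WExpr.exists_four_pow_depth_le` (`BrentFormulaDepth.lean`, BCS
  (21.35)): depth `δ` with `4^δ ≤ (size + 1)^16`, and `size ≤ formulaComplexity`
  (`exists_wexpr_size_le_formulaComplexity`).

Affine forms are rendered exactly as in `MS2021.IsSPS` (Def 4): `C (γ none) + ∑_k C (γ (some k)) · x_k`
for a coefficient vector `γ : Option (Fin M) → F` (`MS2021.affineForms`). No named fact; the three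
`def`s are proof plumbing with bodies; no `instance`, no `notation`. `VP ≠ VNP` is NOT proved and
nothing here bears on it.

## References
* [MediniShpilka2021] D. Medini, A. Shpilka, CCC 2021, LIPIcs 200:19: Def 7–8 (ANF formulas,
  `ANF_Δ`, p.19:7), Thm 32 eq. (6) and its proof (arXiv:2102.05632 p0008:L12-L16, p0026:L17-L19).
* A. Gupta, N. Kayal, Y. Qiao, *Random arithmetic formulas can be reconstructed efficiently*,
  Comput. Complexity 23 (2014), Prop. 3.2 (as cited by Medini–Shpilka).
* [BurgisserClausenShokrollahi1997] Thm. (21.35) (Brent), p. 592.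
-/

noncomputable section

open MvPolynomial

namespace Literature.Computability.AlgebraicComplexity

universe u v

namespace MS2021

/-! ### Evaluating `ANF_{δ+1}` blockwise -/

section Blocks

variable {α : Type*} {δ : ℕ}

/-- Assemble an assignment of the `4^{δ+1} = 4 · 4^δ` variables of `ANF_{δ+1}` from four assignments
of the blocks `x^{(1)}, …, x^{(4)}` (Def 8: "`x^{(i)}` is the `4^Δ`-tuple of variables …").
[cite: MediniShpilka2021, Def 8 (CCC p.19:7)] -/
def anfBlocks (δ : ℕ) (φ : Fin 4 → Fin (4 ^ δ) → α) : Fin (4 ^ (δ + 1)) → α :=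
  fun x => φ (finProdFinEquiv.symm (Fin.cast (pow_succ' 4 δ) x)).1
    (finProdFinEquiv.symm (Fin.cast (pow_succ' 4 δ) x)).2

/-- The assembled assignment restricts to the given one on each block. [cite: MediniShpilka2021, Def 8 (CCC p.19:7)] -/
theorem anfBlocks_anfBlock (φ : Fin 4 → Fin (4 ^ δ) → α) (i : Fin 4) (j : Fin (4 ^ δ)) :
    anfBlocks δ φ (anfBlock δ i j) = φ i j := by
  have h : Fin.cast (pow_succ' 4 δ) (anfBlock δ i j) = finProdFinEquiv (i, j) := Fin.ext rfl
  simp only [anfBlocks, h, Equiv.symm_apply_apply]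

/-- Every entry of the assembled assignment comes from one of the four blocks. [cite: MediniShpilka2021, Def 8 (CCC p.19:7)] -/
theorem anfBlocks_mem {S : Set α} {φ : Fin 4 → Fin (4 ^ δ) → α} (h : ∀ i j, φ i j ∈ S)
    (x : Fin (4 ^ (δ + 1))) : anfBlocks δ φ x ∈ S :=
  h _ _

end Blocks

section Eval

variable {K : Type u} [CommSemiring K] {R : Type v} [CommSemiring R] [Algebra K R] {δ : ℕ}

/-- `ANF_0(p) = p`. [cite: MediniShpilka2021, Def 8 "ANF_0(x) = x_1" (CCC p.19:7)] -/
theorem aeval_anf_zero (φ : Fin (4 ^ 0) → R) : aeval φ (anf K 0) = φ ⟨0, by norm_num⟩ := by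
  simp [anf]

/-- `ANF_{Δ+1}(x) = ANF_Δ(x^{(1)}) · ANF_Δ(x^{(2)}) + ANF_Δ(x^{(3)}) · ANF_Δ(x^{(4)})`, evaluated.
[cite: MediniShpilka2021, Def 8 (CCC p.19:7)] -/
theorem aeval_anf_succ (φ : Fin (4 ^ (δ + 1)) → R) :
    aeval φ (anf K (δ + 1)) =
      aeval (φ ∘ anfBlock δ 0) (anf K δ) * aeval (φ ∘ anfBlock δ 1) (anf K δ) +
        aeval (φ ∘ anfBlock δ 2) (anf K δ) * aeval (φ ∘ anfBlock δ 3) (anf K δ) := by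
  simp only [anf, map_add, map_mul, aeval_rename]

/-- Blockwise evaluation of `ANF_{δ+1}` on an assembled assignment. [cite: MediniShpilka2021, Def 8 (CCC p.19:7)] -/
theorem aeval_anfBlocks (φ : Fin 4 → Fin (4 ^ δ) → R) :
    aeval (anfBlocks δ φ) (anf K (δ + 1)) =
      aeval (φ 0) (anf K δ) * aeval (φ 1) (anf K δ) + aeval (φ 2) (anf K δ) * aeval (φ 3) (anf K δ) := by
  have h : ∀ i, anfBlocks δ φ ∘ anfBlock δ i = φ i := fun i => funext fun j => anfBlocks_anfBlock φ i j
  rw [aeval_anf_succ, h, h, h, h]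

/-- **Padding a leaf to depth `δ`**: the assignment `(p; 1; 0; 0)` iterated, under which `ANF_δ`
evaluates to `p` (`ANF_{δ+1}(p,1,0,0) = p · 1 + 0 · 0`). [cite: MediniShpilka2021, Def 7–8 (CCC p.19:7)] -/
def anfLeafPad (p : R) : (δ : ℕ) → Fin (4 ^ δ) → R
  | 0 => fun _ => p
  | δ + 1 => anfBlocks δ ![anfLeafPad p δ, anfLeafPad 1 δ, anfLeafPad 0 δ, anfLeafPad 0 δ]

/-- `ANF_δ(pad p) = p`. [cite: MediniShpilka2021, Def 7–8 (CCC p.19:7)] -/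
theorem aeval_anfLeafPad (p : R) : ∀ δ : ℕ, aeval (anfLeafPad p δ) (anf K δ) = p
  | 0 => by rw [anfLeafPad, aeval_anf_zero]
  | δ + 1 => by
    rw [anfLeafPad, aeval_anfBlocks]
    simp only [Matrix.cons_val_zero, Matrix.cons_val_one, Matrix.cons_val]
    rw [aeval_anfLeafPad p δ, aeval_anfLeafPad 1 δ, aeval_anfLeafPad 0 δ]
    ring

/-- The padded assignment only uses the leaves `p`, `1`, `0`. [cite: MediniShpilka2021, Def 7–8 (CCC p.19:7)] -/
theorem anfLeafPad_mem {S : Set R} (h0 : (0 : R) ∈ S) (h1 : (1 : R) ∈ S) {p : R} (hp : p ∈ S) :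
    ∀ (δ : ℕ) (x : Fin (4 ^ δ)), anfLeafPad p δ x ∈ S
  | 0, _ => hp
  | δ + 1, x => by
    rw [anfLeafPad]
    refine anfBlocks_mem (fun i j => ?_) x
    fin_cases i
    · exact anfLeafPad_mem h0 h1 hp δ j
    · exact anfLeafPad_mem h0 h1 h1 δ j
    · exact anfLeafPad_mem h0 h1 h0 δ j
    · exact anfLeafPad_mem h0 h1 h0 δ j

end Eval

/-! ### Affine forms -/

section Affine

variable {K : Type u} [CommSemiring K] {M : ℕ}

variable (K M) in
/-- The affine forms `γ₀ + ∑_k γ_k x_k` in `x_1, …, x_M` (the bottom `Σ` gates of Def 4; the leaves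
`ℓ_i` of an ANF formula, Def 7), presented by coefficient vectors `γ : Option (Fin M) → K` exactly as
in `MS2021.IsSPS`. [cite: MediniShpilka2021, Def 4 and Def 7 (CCC p.19:6–7)] -/
def affineForms : Set (MvPolynomial (Fin M) K) :=
  {p | ∃ γ : Option (Fin M) → K, p = C (γ none) + ∑ k : Fin M, C (γ (some k)) * X k}

/-- Constants are affine forms. [cite: MediniShpilka2021, Def 4 (CCC p.19:6)] -/
theorem C_mem_affineForms (c : K) : (C c : MvPolynomial (Fin M) K) ∈ affineForms K M :=
  ⟨fun o => o.elim c fun _ => 0, by simp⟩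

/-- Variables are affine forms. [cite: MediniShpilka2021, Def 4 (CCC p.19:6)] -/
theorem X_mem_affineForms (j : Fin M) : (X j : MvPolynomial (Fin M) K) ∈ affineForms K M := by
  classical
  refine ⟨fun o => o.elim 0 fun k => if k = j then 1 else 0, ?_⟩
  simp only [Option.elim, map_zero, zero_add]
  rw [Finset.sum_eq_single j]
  · simp
  · intro k _ hk
    rw [if_neg hk, map_zero, zero_mul]
  · intro h
    exact absurd (Finset.mem_univ j) h

/-- `0` is an affine form. [cite: MediniShpilka2021, Def 4 (CCC p.19:6)] -/
theorem zero_mem_affineForms : (0 : MvPolynomial (Fin M) K) ∈ affineForms K M := by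
  simpa using C_mem_affineForms (M := M) (0 : K)

/-- `1` is an affine form. [cite: MediniShpilka2021, Def 4 (CCC p.19:6)] -/
theorem one_mem_affineForms : (1 : MvPolynomial (Fin M) K) ∈ affineForms K M := by
  simpa using C_mem_affineForms (M := M) (1 : K)

end Affine

end MS2021

/-! ### A depth-`δ` formula is an `ANF_δ`-formula -/

namespace WExpr

open MS2021

variable {K : Type u} [CommSemiring K] {M : ℕ}

/-- **Every weighted expression of depth `≤ δ` is `ANF_δ` applied to affine forms** (indeed to
variables and constants): the structural half of [GKQ14, Prop 3.2] as used in the proof of MS Thm 32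
— `x_j`, `c` padded by `ANF_{δ+1}(p,1,0,0) = p`; `c₁ e₁ + c₂ e₂ = ANF_{δ+1}(ℓ¹, c₁, ℓ², c₂)`;
`e₁ e₂ = ANF_{δ+1}(ℓ¹, ℓ², 0, 0)`.
[cite: MediniShpilka2021, Thm 32 eq. (6) proof (arXiv p0026:L17-L19, via [GKQ14, Prop 3.2]); Def 7–8 (CCC p.19:7)] -/
theorem exists_anf_leaves (e : WExpr K (Fin M)) :
    ∀ δ : ℕ, e.depth ≤ δ → ∃ ℓ : Fin (4 ^ δ) → MvPolynomial (Fin M) K,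
      (∀ i, ℓ i ∈ affineForms K M) ∧ aeval ℓ (anf K δ) = e.eval := by
  induction e with
  | var j =>
    intro δ _
    exact ⟨anfLeafPad (X j) δ,
      anfLeafPad_mem zero_mem_affineForms one_mem_affineForms (X_mem_affineForms j) δ,
      by rw [aeval_anfLeafPad, eval_var]⟩
  | const c =>
    intro δ _
    exact ⟨anfLeafPad (C c) δ,
      anfLeafPad_mem zero_mem_affineForms one_mem_affineForms (C_mem_affineForms c) δ,
      by rw [aeval_anfLeafPad, eval_const]⟩
  | lin c₁ e₁ c₂ e₂ ih₁ ih₂ =>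
    intro δ hδ
    obtain ⟨δ, rfl⟩ : ∃ δ', δ = δ' + 1 := ⟨δ - 1, by rw [depth_lin] at hδ; omega⟩
    rw [depth_lin] at hδ
    obtain ⟨ℓ₁, hℓ₁, he₁⟩ := ih₁ δ (by omega)
    obtain ⟨ℓ₂, hℓ₂, he₂⟩ := ih₂ δ (by omega)
    refine ⟨anfBlocks δ ![ℓ₁, anfLeafPad (C c₁) δ, ℓ₂, anfLeafPad (C c₂) δ],
      anfBlocks_mem fun i j => ?_, ?_⟩
    · fin_cases i
      · exact hℓ₁ j
      · exact anfLeafPad_mem zero_mem_affineForms one_mem_affineForms (C_mem_affineForms c₁) δ j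
      · exact hℓ₂ j
      · exact anfLeafPad_mem zero_mem_affineForms one_mem_affineForms (C_mem_affineForms c₂) δ j
    · rw [aeval_anfBlocks]
      simp only [Matrix.cons_val_zero, Matrix.cons_val_one, Matrix.cons_val]
      rw [he₁, he₂, aeval_anfLeafPad, aeval_anfLeafPad, eval_lin, smul_eq_C_mul, smul_eq_C_mul]
      ring
  | mul e₁ e₂ ih₁ ih₂ =>
    intro δ hδ
    obtain ⟨δ, rfl⟩ : ∃ δ', δ = δ' + 1 := ⟨δ - 1, by rw [depth_mul] at hδ; omega⟩
    rw [depth_mul] at hδ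
    obtain ⟨ℓ₁, hℓ₁, he₁⟩ := ih₁ δ (by omega)
    obtain ⟨ℓ₂, hℓ₂, he₂⟩ := ih₂ δ (by omega)
    refine ⟨anfBlocks δ ![ℓ₁, ℓ₂, anfLeafPad 0 δ, anfLeafPad 0 δ],
      anfBlocks_mem fun i j => ?_, ?_⟩
    · fin_cases i
      · exact hℓ₁ j
      · exact hℓ₂ j
      · exact anfLeafPad_mem zero_mem_affineForms one_mem_affineForms zero_mem_affineForms δ j
      · exact anfLeafPad_mem zero_mem_affineForms one_mem_affineForms zero_mem_affineForms δ j
    · rw [aeval_anfBlocks]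
      simp only [Matrix.cons_val_zero, Matrix.cons_val_one, Matrix.cons_val]
      rw [he₁, he₂, aeval_anfLeafPad, eval_mul]
      ring

end WExpr

namespace MS2021

variable {K : Type u} [CommSemiring K] {M : ℕ}

/-- **Every polynomial is a polynomial-size ANF formula** ([GKQ14, Prop 3.2] as used by MS Thm 32,
with the tree's constants): `g = ANF_Δ(ℓ_1, …, ℓ_{4^Δ})` for affine forms `ℓ_i` (coefficient vectors
`β i`) with `4^Δ ≤ (E(g) + 1)^16`, `E(g)` the fan-in-two formula size `formulaComplexity g` — by
Brent's depth reduction (`WExpr.exists_four_pow_depth_le`) and `WExpr.exists_anf_leaves`.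
[cite: MediniShpilka2021, Thm 32 eq. (6) proof (arXiv p0026:L17-L19: "every size-s formula has an ANF formula of size O(s⁴)" [GKQ14, Prop 3.2]); Def 7–8 (CCC p.19:7)] -/
theorem exists_anf_affine_of_formulaComplexity (g : MvPolynomial (Fin M) K) :
    ∃ (Δ : ℕ) (β : Fin (4 ^ Δ) → Option (Fin M) → K),
      4 ^ Δ ≤ (formulaComplexity g + 1) ^ 16 ∧
        g = aeval (fun i => C (β i none) + ∑ k : Fin M, C (β i (some k)) * X k) (anf K Δ) := by
  obtain ⟨e, he, hs⟩ := exists_wexpr_size_le_formulaComplexity g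
  obtain ⟨e', he', hd⟩ := e.exists_four_pow_depth_le
  obtain ⟨ℓ, hℓ, hval⟩ := e'.exists_anf_leaves e'.depth le_rfl
  choose β hβ using hℓ
  refine ⟨e'.depth, β, hd.trans (Nat.pow_le_pow_left (Nat.succ_le_succ hs) 16), ?_⟩
  have hfun : (fun i => C (β i none) + ∑ k : Fin M, C (β i (some k)) * X k) = ℓ :=
    funext fun i => (hβ i).symm
  rw [hfun, hval, he', he]

end MS2021

end Literature.Computability.AlgebraicComplexity

end
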